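import Summits.ValiantsHypothesis.ValiantsHypothesis.Theorems.LacunarySymmetroidMatrixDescartesKernelDefiniteJunctionWindows

/-!
# Kernel-definite junction, part 3: the three gaps of the Newton chain

Helper file for the stub `stub_kernelDefiniteJunction` of the line `junction_ceiling` (crux `MatrixDescartes`,
stmt-ValiantsHypothesis-18050).  For the two-scale family `f Λ = ∑ F i j Λ^{-j} X^{i+j}` (part 2) whose support lies
in the Newton chain with vertices `(0,0)`, `(n₀,0)`, `(I,j₂)`, `(I,J)` — i.e. `i ≤ I`, `j ≤ J` and the seam constraint
`w i ≤ w n₀ + g j` on the support, with `w (I − n₀) = g j₂` — and `Λ = τ^{g+w}`, the three GAPS between the windows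
carry no zero once the obvious monomial dominates:
* `gap_one`:   `x ∈ [L, σ τ^w]`            — vertex `(n₀, 0)` dominates;
* `gap_two`:   `x ∈ [τ^w/σ, τ^{g+w}/ρ]`    — vertex `(I, j₂)` dominates;
* `gap_three`: `x ≥ R τ^{g+w}`             — vertex `(I, J)` dominates.
Each is the gap lemma `eval_ne_zero_of_dominant` of part 2 fed by the comparisons `mono_up` / `mono_down`; the smallness
of `σ, 1/L, 1/ρ, 1/R, 1/τ` against the coefficients is an explicit hypothesis (`hsmall`). [folklore]
-/

-- `Summit.ValiantsHypothesis.ValiantsHypothesis.…` is the tree's mandated single-conjunct layout (Sub = Summit).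
set_option linter.dupNamespace false
set_option autoImplicit false

namespace Summit.ValiantsHypothesis.ValiantsHypothesis.Theorems.LacunarySymmetroidMatrixDescartes.JunctionCeiling

open Polynomial Filter Set Finset
open scoped BigOperators

/-- `Λ⁻¹ ^ j = τ⁻¹ ^ ((g+w) j)` for `Λ = τ^{g+w}`. [folklore] -/
theorem inv_pow_pow_eq (τ : ℝ) (N j : ℕ) : ((τ ^ N)⁻¹) ^ j = (τ⁻¹) ^ (N * j) := by
  rw [← inv_pow, ← pow_mul]

/-- a power `θ^k` with `k ≥ 1` of a number `θ ∈ [0, 1]` is at most `θ`. [folklore] -/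
theorem pow_le_self_of_le_one {θ : ℝ} (h0 : 0 ≤ θ) (h1 : θ ≤ 1) {k : ℕ} (hk : 1 ≤ k) : θ ^ k ≤ θ := by
  calc θ ^ k ≤ θ ^ 1 := pow_le_pow_of_le_one h0 h1 hk
    _ = θ := pow_one θ

/-- The common final step of the three gaps: a monomial bounded by `gain · main` with `|F i j| · gain` small is
dominated in the form the gap lemma wants. [folklore] -/
theorem term_le_of_gain (τ x gain D Fij F₀ : ℝ) (N p q j j₀ : ℕ)
    (hxq : 0 ≤ x ^ q * (τ⁻¹) ^ (N * j₀))
    (hle : x ^ p * (τ⁻¹) ^ (N * j) ≤ gain * (x ^ q * (τ⁻¹) ^ (N * j₀)))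
    (hsmall : |Fij| * gain ≤ |F₀| / D) :
    |Fij| * ((τ ^ N)⁻¹) ^ j * x ^ p ≤ |F₀| * ((τ ^ N)⁻¹) ^ j₀ * x ^ q / D := by
  rw [inv_pow_pow_eq, inv_pow_pow_eq]
  calc |Fij| * (τ⁻¹) ^ (N * j) * x ^ p = |Fij| * (x ^ p * (τ⁻¹) ^ (N * j)) := by ring
    _ ≤ |Fij| * (gain * (x ^ q * (τ⁻¹) ^ (N * j₀))) := mul_le_mul_of_nonneg_left hle (abs_nonneg _)
    _ = (|Fij| * gain) * (x ^ q * (τ⁻¹) ^ (N * j₀)) := by ring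
    _ ≤ (|F₀| / D) * (x ^ q * (τ⁻¹) ^ (N * j₀)) := mul_le_mul_of_nonneg_right hsmall hxq
    _ = |F₀| * (τ⁻¹) ^ (N * j₀) * x ^ q / D := by ring

/-- **Gap 1** (`L ≤ x ≤ σ τ^w`, vertex `(n₀, 0)`). [folklore] -/
theorem gap_one (F : ℕ → ℕ → ℝ) (I J n₀ g w : ℕ) (hw : 0 < w) (hn₀ : n₀ ≤ I)
    (hN2 : ∀ i j, F i j ≠ 0 → w * i ≤ w * n₀ + g * j) (hF₀ : F n₀ 0 ≠ 0)
    (f : ℝ → ℝ[X])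
    (hf : ∀ Λ, f Λ = ∑ i ∈ range (I + 1), ∑ j ∈ range (J + 1), C (F i j * (Λ⁻¹) ^ j) * X ^ (i + j))
    (τ σ L x : ℝ) (hτ : 1 ≤ τ) (hσ : 0 < σ) (hσ1 : σ ≤ 1) (hL : 1 ≤ L) (hx : L ≤ x ∧ x ≤ σ * τ ^ w)
    (hsmall : ∀ i j, |F i j| * σ ≤ |F n₀ 0| / (2 * (((I : ℝ) + 1) * ((J : ℝ) + 1))) ∧
      |F i j| * L⁻¹ ≤ |F n₀ 0| / (2 * (((I : ℝ) + 1) * ((J : ℝ) + 1))) ∧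
      |F i j| * τ⁻¹ ≤ |F n₀ 0| / (2 * (((I : ℝ) + 1) * ((J : ℝ) + 1)))) :
    (f (τ ^ (g + w))).eval x ≠ 0 := by
  have hτ0 : 0 < τ := by linarith
  have hx0 : 0 < x := by linarith [hx.1]
  have hD : (0 : ℝ) < 2 * (((I : ℝ) + 1) * ((J : ℝ) + 1)) := by positivity
  refine eval_ne_zero_of_dominant F I J f hf _ x (pow_pos hτ0 _) hx0 n₀ 0 hn₀ (Nat.zero_le _) hF₀
    fun i _ j _ hne => ?_
  by_cases hFij : F i j = 0
  · rw [hFij, abs_zero, zero_mul, zero_mul]; positivity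
  obtain ⟨hsσ, hsL, hsτ⟩ := hsmall i j
  have hN := hN2 i j hFij
  have hxq : (0 : ℝ) ≤ x ^ (n₀ + 0) * (τ⁻¹) ^ ((g + w) * 0) := by positivity
  rcases lt_trichotomy (i + j) n₀ with hlt | heq | hgt
  · -- lower `x`-degree: dominated for `x ≥ L`
    have h := mono_down τ x L hτ hx0 (by linarith) 0 (i + j) (n₀ + 0) ((g + w) * j) ((g + w) * 0) 0
      (by omega) (by simp) (by simpa using hx.1)
    have hG : L⁻¹ ^ (n₀ + 0 - (i + j)) * (τ⁻¹) ^ 0 ≤ L⁻¹ := by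
      rw [pow_zero, mul_one]
      exact pow_le_self_of_le_one (by positivity) (inv_le_one_of_one_le₀ hL) (by omega)
    exact term_le_of_gain τ x L⁻¹ _ (F i j) (F n₀ 0) (g + w) (i + j) (n₀ + 0) j 0 hxq
      (h.trans (mul_le_mul_of_nonneg_right hG hxq)) hsL
  · -- same `x`-degree, `j ≥ 1`: dominated by the factor `τ⁻¹`
    have hj : 1 ≤ j := by
      rcases Nat.eq_zero_or_pos j with h0 | h0
      · exact absurd (Prod.ext_iff.2 ⟨by simpa [h0] using heq, h0⟩) hne
      · exact h0
    have hexp : w * (i + j - (n₀ + 0)) + (g + w) * 0 + 1 ≤ (g + w) * j := by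
      rw [add_zero, heq, Nat.sub_self, mul_zero, mul_zero, zero_add, zero_add]
      calc 1 = 1 * 1 := rfl
        _ ≤ (g + w) * j := Nat.mul_le_mul (by omega) hj
    have h := mono_up τ x σ hτ hx0 hσ w (i + j) (n₀ + 0) ((g + w) * j) ((g + w) * 0) 1 (by omega) hexp hx.2
    have hG : σ ^ (i + j - (n₀ + 0)) * (τ⁻¹) ^ 1 ≤ τ⁻¹ := by
      rw [add_zero, heq, Nat.sub_self, pow_zero, one_mul, pow_one]
    exact term_le_of_gain τ x τ⁻¹ _ (F i j) (F n₀ 0) (g + w) (i + j) (n₀ + 0) j 0 hxq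
      (h.trans (mul_le_mul_of_nonneg_right hG hxq)) hsτ
  · -- higher `x`-degree: dominated for `x ≤ σ τ^w` by the seam constraint
    obtain ⟨k, hk⟩ := Nat.exists_eq_add_of_lt hgt
    have hk1 : i + j - (n₀ + 0) = k + 1 := by omega
    have hexp : w * (i + j - (n₀ + 0)) + (g + w) * 0 + 0 ≤ (g + w) * j := by
      rw [hk1, mul_zero, add_zero, add_zero]
      have e1 : w * i + w * j = w * n₀ + w * (k + 1) := by rw [← mul_add, hk]; ring
      have e2 : (g + w) * j = g * j + w * j := add_mul _ _ _
      generalize w * i = A, w * j = B, w * n₀ = C0, w * (k + 1) = Dk, g * j = E0 at e1 e2 hN ⊢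
      omega
    have h := mono_up τ x σ hτ hx0 hσ w (i + j) (n₀ + 0) ((g + w) * j) ((g + w) * 0) 0 hgt.le hexp hx.2
    have hG : σ ^ (i + j - (n₀ + 0)) * (τ⁻¹) ^ 0 ≤ σ := by
      rw [pow_zero, mul_one]
      exact pow_le_self_of_le_one hσ.le hσ1 (by omega)
    exact term_le_of_gain τ x σ _ (F i j) (F n₀ 0) (g + w) (i + j) (n₀ + 0) j 0 hxq
      (h.trans (mul_le_mul_of_nonneg_right hG hxq)) hsσ

/-- **Gap 2** (`τ^w / σ ≤ x ≤ τ^{g+w} / ρ`, vertex `(I, j₂)`). [folklore] -/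
theorem gap_two (F : ℕ → ℕ → ℝ) (I J n₀ j₂ g w : ℕ) (hw : 0 < w) (hn₀ : n₀ ≤ I) (hj₂ : j₂ ≤ J)
    (hC : w * (I - n₀) = g * j₂) (hFI : ∀ i j, F i j ≠ 0 → i ≤ I)
    (hN2 : ∀ i j, F i j ≠ 0 → w * i ≤ w * n₀ + g * j) (hF₂ : F I j₂ ≠ 0)
    (f : ℝ → ℝ[X])
    (hf : ∀ Λ, f Λ = ∑ i ∈ range (I + 1), ∑ j ∈ range (J + 1), C (F i j * (Λ⁻¹) ^ j) * X ^ (i + j))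
    (τ σ ρ x : ℝ) (hτ : 1 ≤ τ) (hσ : 0 < σ) (hσ1 : σ ≤ 1) (hρ : 1 ≤ ρ)
    (hx : σ⁻¹ * τ ^ w ≤ x ∧ x ≤ ρ⁻¹ * τ ^ (g + w))
    (hsmall : ∀ i j, |F i j| * σ ≤ |F I j₂| / (2 * (((I : ℝ) + 1) * ((J : ℝ) + 1))) ∧
      |F i j| * ρ⁻¹ ≤ |F I j₂| / (2 * (((I : ℝ) + 1) * ((J : ℝ) + 1))) ∧
      |F i j| * τ⁻¹ ≤ |F I j₂| / (2 * (((I : ℝ) + 1) * ((J : ℝ) + 1)))) :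
    (f (τ ^ (g + w))).eval x ≠ 0 := by
  have hτ0 : 0 < τ := by linarith
  have hx0 : 0 < x := lt_of_lt_of_le (by positivity) hx.1
  have hD : (0 : ℝ) < 2 * (((I : ℝ) + 1) * ((J : ℝ) + 1)) := by positivity
  refine eval_ne_zero_of_dominant F I J f hf _ x (pow_pos hτ0 _) hx0 I j₂ le_rfl hj₂ hF₂
    fun i _ j _ hne => ?_
  by_cases hFij : F i j = 0
  · rw [hFij, abs_zero, zero_mul, zero_mul]; positivity
  obtain ⟨hsσ, hsρ, hsτ⟩ := hsmall i j
  have hN := hN2 i j hFij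
  have hiI := hFI i j hFij
  have hC' : w * I = w * n₀ + g * j₂ := by
    have : w * (I - n₀) + w * n₀ = w * I := by rw [← mul_add, Nat.sub_add_cancel hn₀]
    omega
  have hxq : (0 : ℝ) ≤ x ^ (I + j₂) * (τ⁻¹) ^ ((g + w) * j₂) := by positivity
  rcases lt_trichotomy (i + j) (I + j₂) with hlt | heq | hgt
  · -- lower `x`-degree: dominated for `x ≥ τ^w/σ` by the seam constraint
    obtain ⟨k, hk⟩ := Nat.exists_eq_add_of_lt hlt
    have hk1 : I + j₂ - (i + j) = k + 1 := by omega
    have hexp : (g + w) * j₂ + 0 ≤ w * (I + j₂ - (i + j)) + (g + w) * j := by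
      rw [hk1, add_zero]
      have e1 : w * I + w * j₂ = w * i + w * j + w * (k + 1) := by
        rw [← mul_add, hk]; ring
      have e2 : (g + w) * j = g * j + w * j := add_mul _ _ _
      have e3 : (g + w) * j₂ = g * j₂ + w * j₂ := add_mul _ _ _
      generalize w * i = A, w * j = B, w * n₀ = C0, w * (k + 1) = Dk, g * j = E0, w * I = WI,
        w * j₂ = Wj, g * j₂ = Gj at e1 e2 e3 hN hC' ⊢
      omega
    have h := mono_down τ x σ⁻¹ hτ hx0 (by positivity) w (i + j) (I + j₂) ((g + w) * j)
      ((g + w) * j₂) 0 hlt.le hexp hx.1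
    have hG : σ⁻¹⁻¹ ^ (I + j₂ - (i + j)) * (τ⁻¹) ^ 0 ≤ σ := by
      rw [inv_inv, pow_zero, mul_one]
      exact pow_le_self_of_le_one hσ.le hσ1 (by omega)
    exact term_le_of_gain τ x σ _ (F i j) (F I j₂) (g + w) (i + j) (I + j₂) j j₂ hxq
      (h.trans (mul_le_mul_of_nonneg_right hG hxq)) hsσ
  · -- same `x`-degree, `j > j₂`: factor `τ⁻¹`
    have hj : j₂ + 1 ≤ j := by
      by_contra hcon
      have hjj : j = j₂ := by omega
      have hii : i = I := by omega
      exact hne (Prod.ext_iff.2 ⟨hii, hjj⟩)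
    have hexp : (g + w) * (i + j - (I + j₂)) + (g + w) * j₂ + 1 ≤ (g + w) * j := by
      rw [heq, Nat.sub_self, mul_zero, zero_add]
      calc (g + w) * j₂ + 1 ≤ (g + w) * j₂ + (g + w) * 1 := by omega
        _ = (g + w) * (j₂ + 1) := by ring
        _ ≤ (g + w) * j := Nat.mul_le_mul_left _ hj
    have h := mono_up τ x ρ⁻¹ hτ hx0 (by positivity) (g + w) (i + j) (I + j₂) ((g + w) * j)
      ((g + w) * j₂) 1 heq.ge hexp hx.2
    have hG : ρ⁻¹ ^ (i + j - (I + j₂)) * (τ⁻¹) ^ 1 ≤ τ⁻¹ := by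
      rw [heq, Nat.sub_self, pow_zero, one_mul, pow_one]
    exact term_le_of_gain τ x τ⁻¹ _ (F i j) (F I j₂) (g + w) (i + j) (I + j₂) j j₂ hxq
      (h.trans (mul_le_mul_of_nonneg_right hG hxq)) hsτ
  · -- higher `x`-degree: dominated for `x ≤ τ^{g+w}/ρ` since `i ≤ I`
    obtain ⟨k, hk⟩ := Nat.exists_eq_add_of_lt hgt
    have hk1 : i + j - (I + j₂) = k + 1 := by omega
    have hexp : (g + w) * (i + j - (I + j₂)) + (g + w) * j₂ + 0 ≤ (g + w) * j := by
      rw [hk1, add_zero, ← mul_add]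
      exact Nat.mul_le_mul_left _ (by omega)
    have h := mono_up τ x ρ⁻¹ hτ hx0 (by positivity) (g + w) (i + j) (I + j₂) ((g + w) * j)
      ((g + w) * j₂) 0 hgt.le hexp hx.2
    have hG : ρ⁻¹ ^ (i + j - (I + j₂)) * (τ⁻¹) ^ 0 ≤ ρ⁻¹ := by
      rw [pow_zero, mul_one]
      exact pow_le_self_of_le_one (by positivity) (inv_le_one_of_one_le₀ hρ) (by omega)
    exact term_le_of_gain τ x ρ⁻¹ _ (F i j) (F I j₂) (g + w) (i + j) (I + j₂) j j₂ hxq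
      (h.trans (mul_le_mul_of_nonneg_right hG hxq)) hsρ

/-- **Gap 3** (`x ≥ R τ^{g+w}`, vertex `(I, J)`). [folklore] -/
theorem gap_three (F : ℕ → ℕ → ℝ) (I J g w : ℕ) (hFI : ∀ i j, F i j ≠ 0 → i ≤ I)
    (hFJ : ∀ i j, F i j ≠ 0 → j ≤ J) (hF₃ : F I J ≠ 0)
    (f : ℝ → ℝ[X])
    (hf : ∀ Λ, f Λ = ∑ i ∈ range (I + 1), ∑ j ∈ range (J + 1), C (F i j * (Λ⁻¹) ^ j) * X ^ (i + j))
    (τ R x : ℝ) (hτ : 1 ≤ τ) (hR : 1 ≤ R) (hx : R * τ ^ (g + w) ≤ x)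
    (hsmall : ∀ i j, |F i j| * R⁻¹ ≤ |F I J| / (2 * (((I : ℝ) + 1) * ((J : ℝ) + 1)))) :
    (f (τ ^ (g + w))).eval x ≠ 0 := by
  have hτ0 : 0 < τ := by linarith
  have hx0 : 0 < x := lt_of_lt_of_le (by positivity) hx
  have hD : (0 : ℝ) < 2 * (((I : ℝ) + 1) * ((J : ℝ) + 1)) := by positivity
  refine eval_ne_zero_of_dominant F I J f hf _ x (pow_pos hτ0 _) hx0 I J le_rfl le_rfl hF₃
    fun i _ j _ hne => ?_
  by_cases hFij : F i j = 0
  · rw [hFij, abs_zero, zero_mul, zero_mul]; positivity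
  have hiI := hFI i j hFij
  have hjJ := hFJ i j hFij
  have hlt : i + j < I + J := by
    rcases Nat.lt_or_ge (i + j) (I + J) with h | h
    · exact h
    · exact absurd (Prod.ext_iff.2 ⟨by simp; omega, by simp; omega⟩) hne
  have hxq : (0 : ℝ) ≤ x ^ (I + J) * (τ⁻¹) ^ ((g + w) * J) := by positivity
  obtain ⟨k, hk⟩ := Nat.exists_eq_add_of_lt hlt
  have hk1 : I + J - (i + j) = k + 1 := by omega
  have hexp : (g + w) * J + 0 ≤ (g + w) * (I + J - (i + j)) + (g + w) * j := by
    rw [hk1, add_zero, ← mul_add]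
    exact Nat.mul_le_mul_left _ (by omega)
  have h := mono_down τ x R hτ hx0 (by linarith) (g + w) (i + j) (I + J) ((g + w) * j) ((g + w) * J) 0
    hlt.le hexp hx
  have hG : R⁻¹ ^ (I + J - (i + j)) * (τ⁻¹) ^ 0 ≤ R⁻¹ := by
    rw [pow_zero, mul_one]
    exact pow_le_self_of_le_one (by positivity) (inv_le_one_of_one_le₀ hR) (by omega)
  exact term_le_of_gain τ x R⁻¹ _ (F i j) (F I J) (g + w) (i + j) (I + J) j J hxq
    (h.trans (mul_le_mul_of_nonneg_right hG hxq)) (hsmall i j)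

end Summit.ValiantsHypothesis.ValiantsHypothesis.Theorems.LacunarySymmetroidMatrixDescartes.JunctionCeiling
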